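import Summits.Ventures.Crystal3D.Theorems.StickyWulffConstantPolycrystalWulffBoundHyperplaneNull

/-!
# `PolycrystalWulffBound`: refining a polyhedral set into the disjoint cells of its hyperplane arrangement

Route `StickyWulffConstant` of the venture `Summits/Ventures/Crystal3D`, crux `PolycrystalWulffBound`
(item `stmt-Ventures-19482`), second prover lane.  The registered stub `stub_polyhedral` of line
PolyDensity takes POLYHEDRAL grains `Poly S : S = ⋃ i, ⋂ p ∈ H i, {x | ⟪p.1, x⟫ < p.2}` — finite
unions of open H-polyhedra whose pieces MAY OVERLAP — while the facet calculus
(`PolytopeCalculus` of line TexShadow on `stmt-Ventures-19483`: clause (A) = lit g8's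
`anisotropicPerimeter_iInter_halfSpace_lt_eq_facetSum`, clause (B) = eng g7) evaluates the
distributional `K`-perimeter on PAIRWISE DISJOINT open polytopes whose closures meet inside a common
constraint plane.  This file is the bridge: the CELLS of the arrangement of all constraint planes.

For a finite constraint set `𝓗 : Finset (E × ℝ)` and a "positive part" `T : Finset (E × ℝ)` the cell is
the open H-polytope of the SIGNED constraints
`⋂ q ∈ 𝓗.image (fun p => if p ∈ T then p else (-p.1, -p.2)), {x | ⟪q.1, x⟫ < q.2}`
(literally a `polytope` in the sense of TexShadow/PolyDensity).  Proved (all elementary, `E` any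
finite-dimensional real inner product space):
* `mem_arrCell_iff` — membership = the sign conditions;
* `disjoint_arrCell` — cells with different sign at some `p ∈ 𝓗` are disjoint;
* `closure_arrCell_subset`, `closure_arrCell_inter_subset_plane` — closures of two such cells meet
  inside the plane `{⟪p.1, x⟫ = p.2}` (clause (B)'s «separating normal» hypothesis, `ν = p.1`);
* `arrCell_subset_polytope`, `disjoint_arrCell_polytope` — a cell lies inside, or is disjoint from,
  every polytope cut out by constraints `G ⊆ 𝓗` (inside iff `G ⊆ T`);
* `mem_arrCell_filter` — every point off the constraint planes lies in the cell of its own signs;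
* `iUnion_arrCell_subset`, `subset_iUnion_arrCell_union_planes`, `volume_iUnion_planes_eq_zero`,
  **`iUnion_polytope_ae_eq_iUnion_arrCell`** — a finite union of H-polyhedra with constraints from `𝓗`
  (all `p.1 ≠ 0`) is a.e. EQUAL to the (disjoint) union of the good cells `{T ⊆ 𝓗 : ∃ G ∈ 𝒢, G ⊆ T}`,
  and contains it exactly;
* `isBounded_arrCell_of_subset` — good cells are bounded when the pieces are;
* `norm_fst_eq_one_of_mem_signed`, `eq_or_eq_neg_of_setOf_inner_eq` (same plane with unit normals
  ⇒ `(a', b') = ±(a, b)`), `setOf_inner_eq_ne_of_arrCell_nonempty` — clause (A)'s hypotheses (unit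
  normals, pairwise distinct facet planes) hold on every nonempty cell when `𝓗` has unit normals.
WHAT THIS IS NOT: the facet calculus itself, nor the `Fin k'` repackaging with chosen normals
(mechanical, left to the consumer); nothing on the crux beyond bookkeeping.
-/

noncomputable section

namespace Summit.Ventures.Crystal3D.Theorems

open MeasureTheory Set
open scoped RealInnerProductSpace Classical

variable {E : Type*} [NormedAddCommGroup E] [InnerProductSpace ℝ E] [FiniteDimensional ℝ E]
  [MeasurableSpace E] [BorelSpace E]

/-! ### Cells of the arrangement: membership, disjointness, closures -/

omit [FiniteDimensional ℝ E] [MeasurableSpace E] [BorelSpace E] in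
/-- Membership in the cell with positive part `T`: `⟪p.1, x⟫ < p.2` for `p ∈ 𝓗 ∩ T` and
`p.2 < ⟪p.1, x⟫` for `p ∈ 𝓗 \ T`. -/
theorem mem_arrCell_iff (𝓗 T : Finset (E × ℝ)) (x : E) :
    x ∈ (⋂ q ∈ 𝓗.image (fun p : E × ℝ => if p ∈ T then p else (-p.1, -p.2)),
        {y : E | ⟪q.1, y⟫ < q.2}) ↔
      ∀ p ∈ 𝓗, (p ∈ T → ⟪p.1, x⟫ < p.2) ∧ (p ∉ T → p.2 < ⟪p.1, x⟫) := by
  rw [Finset.set_biInter_finset_image]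
  simp only [mem_iInter, mem_setOf_eq]
  refine forall₂_congr fun p _ => ?_
  by_cases hpT : p ∈ T
  · simp [hpT]
  · simp [hpT, inner_neg_left]

omit [FiniteDimensional ℝ E] [MeasurableSpace E] [BorelSpace E] in
/-- Cells with a different sign at some constraint `p ∈ 𝓗` are disjoint. -/
theorem disjoint_arrCell (𝓗 T T' : Finset (E × ℝ)) {p : E × ℝ} (hp : p ∈ 𝓗) (hpT : p ∈ T)
    (hpT' : p ∉ T') :
    Disjoint (⋂ q ∈ 𝓗.image (fun p : E × ℝ => if p ∈ T then p else (-p.1, -p.2)),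
        {y : E | ⟪q.1, y⟫ < q.2})
      (⋂ q ∈ 𝓗.image (fun p : E × ℝ => if p ∈ T' then p else (-p.1, -p.2)),
        {y : E | ⟪q.1, y⟫ < q.2}) := by
  rw [Set.disjoint_left]
  intro x hx hx'
  rw [mem_arrCell_iff] at hx hx'
  have h1 : ⟪p.1, x⟫ < p.2 := (hx p hp).1 hpT
  have h2 : p.2 < ⟪p.1, x⟫ := (hx' p hp).2 hpT'
  exact lt_asymm h1 h2

omit [FiniteDimensional ℝ E] [MeasurableSpace E] [BorelSpace E] in
/-- The closure of a cell lies in the corresponding CLOSED signed half-spaces. -/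
theorem closure_arrCell_subset (𝓗 T : Finset (E × ℝ)) :
    closure (⋂ q ∈ 𝓗.image (fun p : E × ℝ => if p ∈ T then p else (-p.1, -p.2)),
        {y : E | ⟪q.1, y⟫ < q.2}) ⊆
      {x : E | ∀ p ∈ 𝓗, (p ∈ T → ⟪p.1, x⟫ ≤ p.2) ∧ (p ∉ T → p.2 ≤ ⟪p.1, x⟫)} := by
  refine closure_minimal (fun x hx => ?_) ?_
  · rw [mem_arrCell_iff] at hx
    exact fun p hp => ⟨fun hpT => ((hx p hp).1 hpT).le, fun hpT => ((hx p hp).2 hpT).le⟩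
  · have : {x : E | ∀ p ∈ 𝓗, (p ∈ T → ⟪p.1, x⟫ ≤ p.2) ∧ (p ∉ T → p.2 ≤ ⟪p.1, x⟫)} =
        ⋂ p ∈ 𝓗, ({x : E | p ∈ T → ⟪p.1, x⟫ ≤ p.2} ∩ {x : E | p ∉ T → p.2 ≤ ⟪p.1, x⟫}) := by
      ext x; simp only [mem_setOf_eq, mem_iInter, mem_inter_iff]
    rw [this]
    refine isClosed_biInter fun p _ => IsClosed.inter ?_ ?_
    · by_cases hpT : p ∈ T
      · simp only [hpT, forall_true_left]
        exact isClosed_le (continuous_const.inner continuous_id) continuous_const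
      · simp only [hpT, IsEmpty.forall_iff, setOf_true]; exact isClosed_univ
    · by_cases hpT : p ∈ T
      · simp only [hpT, not_true_eq_false, IsEmpty.forall_iff, setOf_true]; exact isClosed_univ
      · simp only [hpT, not_false_eq_true, forall_true_left]
        exact isClosed_le continuous_const (continuous_const.inner continuous_id)

omit [FiniteDimensional ℝ E] [MeasurableSpace E] [BorelSpace E] in
/-- **Common plane** (clause (B)'s hypothesis): if `p ∈ 𝓗` is positive for `T` and negative for
`T'`, the closures of the two cells meet inside the plane `{⟪p.1, x⟫ = p.2}`. -/
theorem closure_arrCell_inter_subset_plane (𝓗 T T' : Finset (E × ℝ)) {p : E × ℝ} (hp : p ∈ 𝓗)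
    (hpT : p ∈ T) (hpT' : p ∉ T') :
    closure (⋂ q ∈ 𝓗.image (fun p : E × ℝ => if p ∈ T then p else (-p.1, -p.2)),
        {y : E | ⟪q.1, y⟫ < q.2}) ∩
      closure (⋂ q ∈ 𝓗.image (fun p : E × ℝ => if p ∈ T' then p else (-p.1, -p.2)),
        {y : E | ⟪q.1, y⟫ < q.2}) ⊆ {x : E | ⟪p.1, x⟫ = p.2} := by
  intro x hx
  have h1 := (closure_arrCell_subset 𝓗 T hx.1) p hp
  have h2 := (closure_arrCell_subset 𝓗 T' hx.2) p hp
  exact le_antisymm (h1.1 hpT) (h2.2 hpT')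

/-! ### Cells versus the polytopes of the family -/

omit [FiniteDimensional ℝ E] [MeasurableSpace E] [BorelSpace E] in
/-- A cell whose positive part contains `G ⊆ 𝓗` lies inside the polytope cut out by `G`. -/
theorem arrCell_subset_polytope (𝓗 T : Finset (E × ℝ)) {G : Finset (E × ℝ)} (hG : G ⊆ 𝓗)
    (hGT : G ⊆ T) :
    (⋂ q ∈ 𝓗.image (fun p : E × ℝ => if p ∈ T then p else (-p.1, -p.2)),
        {y : E | ⟪q.1, y⟫ < q.2}) ⊆ ⋂ p ∈ G, {x : E | ⟪p.1, x⟫ < p.2} := by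
  intro x hx
  rw [mem_arrCell_iff] at hx
  rw [mem_iInter₂]
  exact fun p hp => (hx p (hG hp)).1 (hGT hp)

omit [FiniteDimensional ℝ E] [MeasurableSpace E] [BorelSpace E] in
/-- A cell whose positive part does NOT contain `G ⊆ 𝓗` is disjoint from the polytope of `G`. -/
theorem disjoint_arrCell_polytope (𝓗 T : Finset (E × ℝ)) {G : Finset (E × ℝ)} (hG : G ⊆ 𝓗)
    (hGT : ¬ G ⊆ T) :
    Disjoint (⋂ q ∈ 𝓗.image (fun p : E × ℝ => if p ∈ T then p else (-p.1, -p.2)),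
        {y : E | ⟪q.1, y⟫ < q.2}) (⋂ p ∈ G, {x : E | ⟪p.1, x⟫ < p.2}) := by
  obtain ⟨p, hpG, hpT⟩ := Finset.not_subset.1 hGT
  rw [Set.disjoint_left]
  intro x hx hx'
  rw [mem_arrCell_iff] at hx
  rw [mem_iInter₂] at hx'
  have h1 : p.2 < ⟪p.1, x⟫ := (hx p (hG hpG)).2 hpT
  have h2 : ⟪p.1, x⟫ < p.2 := hx' p hpG
  exact lt_asymm h1 h2

omit [FiniteDimensional ℝ E] [MeasurableSpace E] [BorelSpace E] in
/-- Every point off the constraint planes lies in the cell of its own sign vector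
`T_x = {p ∈ 𝓗 | ⟪p.1, x⟫ < p.2}`. -/
theorem mem_arrCell_filter (𝓗 : Finset (E × ℝ)) {x : E}
    (hx : x ∉ ⋃ p ∈ 𝓗, {y : E | ⟪p.1, y⟫ = p.2}) :
    x ∈ ⋂ q ∈ 𝓗.image (fun p : E × ℝ =>
        if p ∈ 𝓗.filter (fun p => ⟪p.1, x⟫ < p.2) then p else (-p.1, -p.2)),
      {y : E | ⟪q.1, y⟫ < q.2} := by
  rw [mem_arrCell_iff]
  intro p hp
  have hne : ⟪p.1, x⟫ ≠ p.2 := by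
    intro h
    exact hx (mem_iUnion₂.2 ⟨p, hp, h⟩)
  refine ⟨fun h => (Finset.mem_filter.1 h).2, fun h => ?_⟩
  have h' : ¬ ⟪p.1, x⟫ < p.2 := fun hlt => h (Finset.mem_filter.2 ⟨hp, hlt⟩)
  exact lt_of_le_of_ne (not_lt.1 h') (Ne.symm hne)

/-! ### The union of the good cells -/

omit [FiniteDimensional ℝ E] [MeasurableSpace E] [BorelSpace E] in
/-- The good cells (`∃ G ∈ 𝒢, G ⊆ T`) lie inside the polyhedral set `⋃_{G ∈ 𝒢} polytope G`. -/
theorem iUnion_arrCell_subset (𝓗 : Finset (E × ℝ)) (𝒢 : Finset (Finset (E × ℝ)))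
    (h𝒢 : ∀ G ∈ 𝒢, G ⊆ 𝓗) :
    (⋃ T ∈ 𝓗.powerset.filter (fun T => ∃ G ∈ 𝒢, G ⊆ T),
      ⋂ q ∈ 𝓗.image (fun p : E × ℝ => if p ∈ T then p else (-p.1, -p.2)),
        {y : E | ⟪q.1, y⟫ < q.2}) ⊆ ⋃ G ∈ 𝒢, ⋂ p ∈ G, {x : E | ⟪p.1, x⟫ < p.2} := by
  intro x hx
  rw [mem_iUnion₂] at hx
  obtain ⟨T, hT, hxT⟩ := hx
  obtain ⟨-, G, hG, hGT⟩ := Finset.mem_filter.1 hT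
  exact mem_iUnion₂.2 ⟨G, hG, arrCell_subset_polytope 𝓗 T (h𝒢 G hG) hGT hxT⟩

omit [FiniteDimensional ℝ E] [MeasurableSpace E] [BorelSpace E] in
/-- The polyhedral set is covered by the good cells together with the constraint planes. -/
theorem subset_iUnion_arrCell_union_planes (𝓗 : Finset (E × ℝ)) (𝒢 : Finset (Finset (E × ℝ)))
    (h𝒢 : ∀ G ∈ 𝒢, G ⊆ 𝓗) :
    (⋃ G ∈ 𝒢, ⋂ p ∈ G, {x : E | ⟪p.1, x⟫ < p.2}) ⊆
      (⋃ T ∈ 𝓗.powerset.filter (fun T => ∃ G ∈ 𝒢, G ⊆ T),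
        ⋂ q ∈ 𝓗.image (fun p : E × ℝ => if p ∈ T then p else (-p.1, -p.2)),
          {y : E | ⟪q.1, y⟫ < q.2}) ∪ ⋃ p ∈ 𝓗, {y : E | ⟪p.1, y⟫ = p.2} := by
  intro x hx
  by_cases hxN : x ∈ ⋃ p ∈ 𝓗, {y : E | ⟪p.1, y⟫ = p.2}
  · exact Or.inr hxN
  · left
    rw [mem_iUnion₂] at hx
    obtain ⟨G, hG, hxG⟩ := hx
    set T : Finset (E × ℝ) := 𝓗.filter (fun p => ⟪p.1, x⟫ < p.2) with hT
    have hGT : G ⊆ T := by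
      intro p hp
      rw [mem_iInter₂] at hxG
      exact Finset.mem_filter.2 ⟨h𝒢 G hG hp, hxG p hp⟩
    refine mem_iUnion₂.2 ⟨T, Finset.mem_filter.2 ⟨Finset.mem_powerset.2 (Finset.filter_subset _ _),
      G, hG, hGT⟩, ?_⟩
    exact mem_arrCell_filter 𝓗 hxN

/-- The constraint planes form a null set (all normals nonzero). -/
theorem volume_iUnion_planes_eq_zero (𝓗 : Finset (E × ℝ)) (h𝓗 : ∀ p ∈ 𝓗, p.1 ≠ 0) :
    volume (⋃ p ∈ 𝓗, {y : E | ⟪p.1, y⟫ = p.2}) = 0 := by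
  refine (measure_biUnion_null_iff 𝓗.countable_toSet).2 fun p hp => ?_
  exact volume_setOf_inner_eq_zero (h𝓗 p hp) p.2

/-- **A finite union of open H-polyhedra is a.e. the disjoint union of the good cells of its
hyperplane arrangement.** For constraint Finsets `G ∈ 𝒢`, all contained in `𝓗` (all normals nonzero),
`⋃_{G ∈ 𝒢} ⋂_{p ∈ G} {⟪p.1, x⟫ < p.2} =ᵐ ⋃_{T ⊆ 𝓗, ∃ G ∈ 𝒢, G ⊆ T} cell(T)`; the right-hand
side is contained in the left exactly (`iUnion_arrCell_subset`), the cells are pairwise disjoint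
(`disjoint_arrCell`) with closures meeting in common constraint planes
(`closure_arrCell_inter_subset_plane`). -/
theorem iUnion_polytope_ae_eq_iUnion_arrCell (𝓗 : Finset (E × ℝ)) (h𝓗 : ∀ p ∈ 𝓗, p.1 ≠ 0)
    (𝒢 : Finset (Finset (E × ℝ))) (h𝒢 : ∀ G ∈ 𝒢, G ⊆ 𝓗) :
    (⋃ G ∈ 𝒢, ⋂ p ∈ G, {x : E | ⟪p.1, x⟫ < p.2}) =ᵐ[volume]
      (⋃ T ∈ 𝓗.powerset.filter (fun T => ∃ G ∈ 𝒢, G ⊆ T),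
        ⋂ q ∈ 𝓗.image (fun p : E × ℝ => if p ∈ T then p else (-p.1, -p.2)),
          {y : E | ⟪q.1, y⟫ < q.2}) := by
  refine ae_eq_set.2 ⟨?_, ?_⟩
  · refine measure_mono_null ?_ (volume_iUnion_planes_eq_zero 𝓗 h𝓗)
    intro x hx
    rcases subset_iUnion_arrCell_union_planes 𝓗 𝒢 h𝒢 hx.1 with h | h
    · exact absurd h hx.2
    · exact h
  · rw [Set.sdiff_eq_empty.2 (iUnion_arrCell_subset 𝓗 𝒢 h𝒢), measure_empty]

omit [FiniteDimensional ℝ E] [MeasurableSpace E] [BorelSpace E] in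
/-- Good cells are bounded as soon as the pieces of the family are. -/
theorem isBounded_arrCell_of_subset (𝓗 T : Finset (E × ℝ)) {G : Finset (E × ℝ)} (hG : G ⊆ 𝓗)
    (hGT : G ⊆ T) (hGb : Bornology.IsBounded (⋂ p ∈ G, {x : E | ⟪p.1, x⟫ < p.2})) :
    Bornology.IsBounded (⋂ q ∈ 𝓗.image (fun p : E × ℝ => if p ∈ T then p else (-p.1, -p.2)),
        {y : E | ⟪q.1, y⟫ < q.2}) :=
  hGb.subset (arrCell_subset_polytope 𝓗 T hG hGT)


/-! ### Clause (A)'s hypotheses on the cells: unit normals and pairwise distinct facet planes -/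

omit [InnerProductSpace ℝ E] [FiniteDimensional ℝ E] [MeasurableSpace E] [BorelSpace E] in
/-- The signed constraints of a cell have unit normals when `𝓗` has. -/
theorem norm_fst_eq_one_of_mem_signed (𝓗 T : Finset (E × ℝ)) (h1 : ∀ p ∈ 𝓗, ‖p.1‖ = 1)
    {q : E × ℝ} (hq : q ∈ 𝓗.image (fun p : E × ℝ => if p ∈ T then p else (-p.1, -p.2))) :
    ‖q.1‖ = 1 := by
  obtain ⟨p, hp, rfl⟩ := Finset.mem_image.1 hq
  by_cases hpT : p ∈ T
  · simp [hpT, h1 p hp]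
  · simp [hpT, norm_neg, h1 p hp]

omit [FiniteDimensional ℝ E] [MeasurableSpace E] [BorelSpace E] in
/-- Two unit-normal descriptions of the same affine hyperplane agree up to a common sign:
`{⟪a, x⟫ = b} = {⟪a', x⟫ = b'}` with `‖a‖ = ‖a'‖ = 1` forces `(a', b') = ±(a, b)`. -/
theorem eq_or_eq_neg_of_setOf_inner_eq {a a' : E} {b b' : ℝ} (ha : ‖a‖ = 1) (ha' : ‖a'‖ = 1)
    (h : {x : E | ⟪a, x⟫ = b} = {x : E | ⟪a', x⟫ = b'}) :
    (a' = a ∧ b' = b) ∨ (a' = -a ∧ b' = -b) := by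
  have haa : ⟪a, a⟫ = 1 := by rw [real_inner_self_eq_norm_sq, ha, one_pow]
  -- the base point `b • a` lies on both planes
  have hx0 : ⟪a, b • a⟫ = b := by rw [real_inner_smul_right, haa, mul_one]
  have hx0' : ⟪a', b • a⟫ = b' := by
    have : b • a ∈ {x : E | ⟪a', x⟫ = b'} := by rw [← h]; exact hx0
    exact this
  -- `a'` is orthogonal to the orthogonal complement of `a`
  have horth : ∀ y : E, ⟪a, y⟫ = 0 → ⟪a', y⟫ = 0 := by
    intro y hy
    have hmem : b • a + y ∈ {x : E | ⟪a', x⟫ = b'} := by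
      rw [← h]
      show ⟪a, b • a + y⟫ = b
      rw [inner_add_right, hx0, hy, add_zero]
    have h2 : ⟪a', b • a + y⟫ = b' := hmem
    rw [inner_add_right, hx0'] at h2
    linarith
  -- hence `a' ∈ span {a}`
  have hspan : a' ∈ (ℝ ∙ a) := by
    rw [← Submodule.orthogonal_orthogonal (ℝ ∙ a)]
    rw [Submodule.mem_orthogonal]
    intro y hy
    rw [Submodule.mem_orthogonal_singleton_iff_inner_right] at hy
    rw [real_inner_comm]
    exact horth y hy
  obtain ⟨t, ht⟩ := Submodule.mem_span_singleton.1 hspan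
  -- `|t| = 1`
  have htabs : |t| = 1 := by
    have := congrArg norm ht
    rw [norm_smul, ha, mul_one, Real.norm_eq_abs, ha'] at this
    exact this
  have hb' : b' = t * b := by
    rw [← hx0', ← ht, real_inner_smul_left, real_inner_smul_right, haa, mul_one]
  rcases abs_eq (zero_le_one) |>.1 htabs with h1 | h1
  · left
    refine ⟨?_, ?_⟩
    · rw [← ht, h1, one_smul]
    · rw [hb', h1, one_mul]
  · right
    refine ⟨?_, ?_⟩
    · rw [← ht, h1, neg_one_smul]
    · rw [hb', h1, neg_one_mul]

omit [FiniteDimensional ℝ E] [MeasurableSpace E] [BorelSpace E] in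
/-- **Pairwise distinct facet planes** (clause (A)'s hypothesis) on every NONEMPTY cell, when `𝓗` has
unit normals: two distinct signed constraints of a nonempty cell never describe the same plane
(same plane with unit normals means `q' = ±q`; `q' = q` is excluded and `q' = -q` empties the cell). -/
theorem setOf_inner_eq_ne_of_arrCell_nonempty (𝓗 T : Finset (E × ℝ))
    (h1 : ∀ p ∈ 𝓗, ‖p.1‖ = 1)
    (hne : (⋂ q ∈ 𝓗.image (fun p : E × ℝ => if p ∈ T then p else (-p.1, -p.2)),
        {y : E | ⟪q.1, y⟫ < q.2}).Nonempty)
    {q q' : E × ℝ} (hq : q ∈ 𝓗.image (fun p : E × ℝ => if p ∈ T then p else (-p.1, -p.2)))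
    (hq' : q' ∈ 𝓗.image (fun p : E × ℝ => if p ∈ T then p else (-p.1, -p.2))) (hqq' : q ≠ q') :
    {x : E | ⟪q.1, x⟫ = q.2} ≠ {x : E | ⟪q'.1, x⟫ = q'.2} := by
  intro h
  have hn := norm_fst_eq_one_of_mem_signed 𝓗 T h1 hq
  have hn' := norm_fst_eq_one_of_mem_signed 𝓗 T h1 hq'
  rcases eq_or_eq_neg_of_setOf_inner_eq hn hn' h with ⟨h₁, h₂⟩ | ⟨h₁, h₂⟩
  · exact hqq' (Prod.ext h₁.symm h₂.symm)
  · obtain ⟨x, hx⟩ := hne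
    rw [mem_iInter₂] at hx
    have hxq : ⟪q.1, x⟫ < q.2 := hx q hq
    have hxq' : ⟪q'.1, x⟫ < q'.2 := hx q' hq'
    rw [h₁, h₂, inner_neg_left] at hxq'
    linarith

end Summit.Ventures.Crystal3D.Theorems

end
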